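import Summits.ABC.IUTFork.Cor312PilotKummerCompat
import HarnessLib

/-!
# R-H ROUND 2, Q2 (kernel target, generic half): «S_H restricted to a stratum Σ ⟹ Cor. 3.12 WEAKENED by the off-Σ remainder»

abc-iut cell, rung LADDER-ABC:A2.RESCUE.H, R-H ROUND 2 (21-frontier charge 2026-08-26T19:41:28Z, Q2: «for each kept row, type
'S restricted to Σ ⟹ (weakened) Cor 3.12 ⟹ abc-with-worse-constant' as a kernel target»); seat abc-iut-rh2-q2-eq (rows 3/4/5, the
EQUIVALENCE / locator rows: Σ = HullCell-POS / tame-ball strata). This file is the ROW-INDEPENDENT half, at the level of abc-iut-c312-7's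
VERBATIM setting `Cor312.Setting` (any Θ-index, any situation): the companion `RHSigmaStrataEq.lean` instantiates it at the genuine bed
`Thm311.Real.settingPrVolSharp (Cor312Prov.pilotDataOfK D K) …` with the strata Σ₃ / Σ₄ / Σ₅ of the signed ROUND-1 list (rh-lead 19:59:53Z).

WHAT IS TYPED (reading predicates and real numbers over a setting `P`; cells are `t = (i, v_ℚ)`, label `j = i+1 ∈ 𝔽_l^⋇`, packet `v_ℚ`):
* `LicenceOn P Σ` — the (xi-f) licence «q-pilot region ⊆ holomorphic hull ⁿ˚𝒰_{j,v_ℚ}» demanded ONLY at the cells of `Σ` (`Σ = univ`: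
  abc-iut-c312-1's `Thm311ToCor312.Licence`, i.e. branch C's S_H antecedent `PilotKummerCompatHull` under the q-pin); `licenceCells P` —
  the cells where it holds (so `LicenceOn P Σ ↔ Σ ⊆ licenceCells P`: «the hypothesis is TRUE precisely on Σ_lic»).
* `cellDeficit P i v_ℚ := ln ν̄(q-region) − ln ν̄(ⁿ˚𝒰)` at the cell; `offRemainder P Σ := (1/l⋇)·Σ_j Σ_{v_ℚ, (j,v_ℚ) ∉ Σ} (cellDeficit)⁺` —
  the OFF-Σ REMAINDER (procession-normalised, `≥ 0`, antitone in `Σ`, `= 0` at `Σ = univ`).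
* `StatementUpTo P ε` — **Cor. 3.12 WEAKENED BY `ε`**: «`−|log(Θ)| ∈ ℝ` and `−|log(q)| ≤ −|log(Θ)| + ε`» (`ε = 0`: the printed `Statement`).
RESULTS (all PROVED, standard axioms): `statementUpTo_offRemainder_of_licenceOn` — under the bridge hypotheses, **`LicenceOn P Σ ⟹
StatementUpTo P (offRemainder P Σ)`** (cell-wise: monotonicity of the log-volume on `Σ`, the deficit's positive part off `Σ`; then
Prop. 3.9 (i)/(iii) bookkeeping); the HYPOTHESIS-FREE corollary `statementUpTo_offRemainder_licenceCells` (Σ := the licence cells themselves: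
the printed inequality ALWAYS holds up to the deficit of the cells where OUR typed licence fails — the honest kernel content of «S_H is true
precisely on Σ»); `statement_of_licenceOn_of_offRemainder_nonpos` (remainder `≤ 0` ⟹ the printed Statement); monotonicity / antitonicity
lemmas; and the IDELE-ONLY majorant `offRemainder_le_offImageGap`: the deficit of a cell is at most «q-volume − volume of ANY possible image»
(e.g. the (Ind3)-enlarged Θ-pilot region), so the remainder never needs the hull itself to be bounded from above.
Downstream («StatementUpTo ⟹ abc with a worse constant», the ε-budget abc tolerates) is seat abc-iut-rh2-q2-cond's certificate in
`Conditional/`; the closed form of `offRemainder` at the genuine bed is Q1 (abc-iut-rh2-xi-1).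

HONEST FRAMING: nothing here asserts that abc is proved or refuted, or that [IUTchIII] Cor. 3.12 holds or fails at any datum, or takes a side
on any author (Mochizuki / Scholze–Stix / Joshi / Dupuy–Hilado); `LicenceOn` is a READING PREDICATE about OUR typed hull, never asserted;
`StatementUpTo` is a CLAIM-form weakening of the printed conclusion, never asserted unconditionally except through the proved implications
above; typed ≠ proved; refuted-as-typed ≠ refuted-in-print. [claim: Mochizuki2012, status: disputed] for every IUT locution.
[cite: Mochizuki2012, IUTchIII Cor. 3.12 p. 173–174, Step (xi-f) p. 184, Prop. 3.9 (i)(iii) p. 116] [cite: DupuyHilado2025, §3.9, §4.12]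
-/

noncomputable section

open Set Function

namespace Summit.ABC.IUTFork.Repair.RH.SigmaLicence

open Summit.ABC.IUTFork.Thm311 Summit.ABC.IUTFork.Cor312 Summit.ABC.IUTFork.Cor312.Setting Summit.ABC.IUTFork.Cor312Vol
  Literature.IUT.LogThetaLattice

variable {T : ThetaIndex} {S : Situation T} (P : Cor312.Setting S)

/-! ## §1. Procession-normalisation bookkeeping (Prop. 3.9 (i): the average over `j ∈ 𝔽_l^⋇` is additive and monotone) -/

/-- The procession-normalised average is sub-additive-monotone: `f ≤ g + h` pointwise gives `PN f ≤ PN g + PN h` (additivity is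
abc-iut-rp-h3's `CandDupuyHilado31.processionNormalized_add`, monotonicity abc-iut-rp-m1's `Cor312Vol.RamifiedWitness.processionNormalized_mono`;
combined here to keep this file's imports minimal). [folklore] -/
theorem processionNormalized_le_add {lstar : ℕ} {f g h : Fin lstar → ℝ} (hle : ∀ i, f i ≤ g i + h i) :
    processionNormalized f ≤ processionNormalized g + processionNormalized h := by
  unfold processionNormalized
  rw [← add_div, ← Finset.sum_add_distrib]
  exact div_le_div_of_nonneg_right (Finset.sum_le_sum fun i _ => hle i) (Nat.cast_nonneg _)

/-- The procession-normalised average of a pointwise non-negative family is non-negative. [folklore] -/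
theorem processionNormalized_nonneg {lstar : ℕ} {f : Fin lstar → ℝ} (h : ∀ i, 0 ≤ f i) :
    0 ≤ processionNormalized f := by
  unfold processionNormalized
  exact div_nonneg (Finset.sum_nonneg fun i _ => h i) (Nat.cast_nonneg _)

/-- The procession-normalised average of the zero family is `0`. [folklore] -/
theorem processionNormalized_zero {lstar : ℕ} : processionNormalized (fun _ : Fin lstar => (0 : ℝ)) = 0 := by
  unfold processionNormalized
  rw [Finset.sum_const_zero, zero_div]

/-! ## §2. The reading predicates and the two numbers -/

/-- **`LicenceOn P Σ` — the (xi-f) licence RESTRICTED TO THE STRATUM `Σ`** of cells `(i, v_ℚ)` (label `j = i+1 ∈ 𝔽_l^⋇`, packet `v_ℚ`):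
at every cell of `Σ` the image of the q-pilot object lies in the holomorphic hull `ⁿ˚𝒰_{j,v_ℚ}` of the union of the possible images of the
Θ-pilot object ([IUTchIII] Cor. 3.12 Step (xi-f), read at region level as abc-iut-c312-1's `Thm311ToCor312.Licence`, here cell by cell).
R-H ROUND 2's «S restricted to Σ». READING PREDICATE about OUR typed hull — never asserted. [claim: Mochizuki2012, status: disputed] -/
@[claim "Mochizuki2012" "disputed"]
def LicenceOn (σ : Set (Fin T.lstar × T.VQ)) : Prop :=
  ∀ t ∈ σ, P.qRegion (labelSucc t.1) t.2 ⊆ P.thetaHull (labelSucc t.1) t.2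

/-- **The licence cells** `Σ_lic(P) := {(i, v_ℚ) | q-region ⊆ ⁿ˚𝒰_{i+1,v_ℚ}}` — the largest stratum on which the restricted licence holds
(«the hypothesis is TRUE precisely on Σ_lic»). [claim: Mochizuki2012, status: disputed] -/
@[claim "Mochizuki2012" "disputed"]
def licenceCells : Set (Fin T.lstar × T.VQ) :=
  {t | P.qRegion (labelSucc t.1) t.2 ⊆ P.thetaHull (labelSucc t.1) t.2}

/-- **The deficit of a cell** `(i, v_ℚ)`: mono-analytic log-volume of the q-pilot image minus that of the packet hull `ⁿ˚𝒰_{i+1,v_ℚ}`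
(both read with the column-`n` log-volume of Thm. 3.11 (i) (a); `≤ 0` wherever the licence holds and the log-volume is monotone).
[claim: Mochizuki2012, status: disputed] -/
@[claim "Mochizuki2012" "disputed"]
def cellDeficit (i : Fin T.lstar) (vQ : T.VQ) : ℝ :=
  P.qLocal (labelSucc i) vQ - (S.D P.n).logvol (labelSucc i) vQ (P.thetaHull (labelSucc i) vQ)

/-- **The off-Σ remainder** `R_Σ(P) := (1/l⋇)·Σ_{j ∈ 𝔽_l^⋇} Σ_{v_ℚ : (j,v_ℚ) ∉ Σ} (cellDeficit)⁺` — the procession-normalised (Prop. 3.9 (i))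
global (Prop. 3.9 (iii)) sum of the positive parts of the deficits of the cells OUTSIDE the stratum. The quantity a Σ-restricted licence
must be charged with in Cor. 3.12 (R-H ROUND 2 Q1's «off-Σ contribution», as a named number). [claim: Mochizuki2012, status: disputed] -/
@[claim "Mochizuki2012" "disputed"]
def offRemainder (σ : Set (Fin T.lstar × T.VQ)) : ℝ :=
  processionNormalized fun i : Fin T.lstar =>
    ∑ᶠ vQ : T.VQ, σᶜ.indicator (fun t : Fin T.lstar × T.VQ => max (cellDeficit P t.1 t.2) 0) (i, vQ)

/-- **`StatementUpTo P ε` — [IUTchIII] Cor. 3.12 WEAKENED BY `ε`**: «`−|log(Θ)| ∈ ℝ` and `−|log(q)| ≤ −|log(Θ)| + ε`» for the verbatim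
quantities of abc-iut-c312-7's setting (at `ε = 0` the printed `Statement`, `statementUpTo_zero_iff`). R-H ROUND 2's «weakened Cor 3.12»;
CLAIM form, never asserted. [claim: Mochizuki2012, status: disputed] -/
@[claim "Mochizuki2012" "disputed"]
def StatementUpTo (ε : ℝ) : Prop :=
  P.negLogTheta ≠ ⊤ ∧ ((P.negLogQ : ℝ) : WithTop ℝ) ≤ P.negLogTheta + ((ε : ℝ) : WithTop ℝ)

/-! ## §3. Elementary structure -/

variable {P}

/-- The restricted licence on `Σ` is the inclusion `Σ ⊆ Σ_lic`. [folklore] -/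
theorem licenceOn_iff_subset_licenceCells {σ : Set (Fin T.lstar × T.VQ)} : LicenceOn P σ ↔ σ ⊆ licenceCells P :=
  Iff.rfl

/-- The licence holds on its own cells. [folklore] -/
theorem licenceOn_licenceCells : LicenceOn P (licenceCells P) := fun _ ht => ht

/-- Restriction to a smaller stratum. [folklore] -/
theorem licenceOn_mono {σ σ' : Set (Fin T.lstar × T.VQ)} (h : σ ⊆ σ') (h' : LicenceOn P σ') : LicenceOn P σ :=
  fun t ht => h' t (h ht)

/-- At `Σ = univ` the restricted licence IS abc-iut-c312-1's (xi-f) `Licence` (branch C's S_H antecedent under the q-pin).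
[claim: Mochizuki2012, status: disputed] -/
theorem licenceOn_univ_iff : LicenceOn P Set.univ ↔ Thm311ToCor312.Licence P :=
  ⟨fun h i vQ => h (i, vQ) (Set.mem_univ _), fun h t _ => h t.1 t.2⟩

/-- `Licence ⟺ Σ_lic = univ`. [claim: Mochizuki2012, status: disputed] -/
theorem licence_iff_licenceCells_eq_univ : Thm311ToCor312.Licence P ↔ licenceCells P = Set.univ := by
  rw [← licenceOn_univ_iff, licenceOn_iff_subset_licenceCells, Set.univ_subset_iff]

/-- The summand of the remainder is pointwise non-negative. [folklore] -/
theorem indicator_deficit_nonneg (σ : Set (Fin T.lstar × T.VQ)) (t : Fin T.lstar × T.VQ) :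
    0 ≤ σᶜ.indicator (fun t : Fin T.lstar × T.VQ => max (cellDeficit P t.1 t.2) 0) t :=
  Set.indicator_nonneg (fun _ _ => le_max_right _ _) t

/-- `R_Σ ≥ 0`. [folklore] -/
theorem offRemainder_nonneg (σ : Set (Fin T.lstar × T.VQ)) : 0 ≤ offRemainder P σ :=
  processionNormalized_nonneg fun _ => finsum_nonneg fun _ => indicator_deficit_nonneg σ _

/-- `R_univ = 0`: demanding the licence everywhere charges nothing. [folklore] -/
theorem offRemainder_univ : offRemainder P Set.univ = 0 := by
  unfold offRemainder
  simp only [Set.compl_univ, Set.indicator_empty, finsum_zero]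
  exact processionNormalized_zero

/-- More generally `R_Σ = 0` as soon as `Σ` contains every cell with a positive deficit. [folklore] -/
theorem offRemainder_eq_zero_of_forall {σ : Set (Fin T.lstar × T.VQ)}
    (h : ∀ t : Fin T.lstar × T.VQ, t ∉ σ → cellDeficit P t.1 t.2 ≤ 0) : offRemainder P σ = 0 := by
  unfold offRemainder
  have hz : ∀ t : Fin T.lstar × T.VQ,
      σᶜ.indicator (fun t : Fin T.lstar × T.VQ => max (cellDeficit P t.1 t.2) 0) t = 0 := by
    intro t
    by_cases ht : t ∈ σ
    · exact Set.indicator_of_notMem (Set.notMem_compl_iff.mpr ht) _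
    · rw [Set.indicator_of_mem (Set.mem_compl ht), max_eq_right (h t ht)]
  simp only [hz, finsum_zero]
  exact processionNormalized_zero

/-- `StatementUpTo P 0` is the printed `Statement`. [claim: Mochizuki2012, status: disputed] -/
theorem statementUpTo_zero_iff : StatementUpTo P 0 ↔ P.Statement := by
  unfold StatementUpTo Setting.Statement
  rw [WithTop.coe_zero, add_zero]

/-- Weakening is monotone in `ε`. [folklore] -/
theorem statementUpTo_mono {ε ε' : ℝ} (h : ε ≤ ε') (hε : StatementUpTo P ε) : StatementUpTo P ε' :=
  ⟨hε.1, hε.2.trans (by gcongr; exact WithTop.coe_le_coe.mpr h)⟩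

/-- The printed Statement gives every non-negative weakening. [claim: Mochizuki2012, status: disputed] -/
theorem statementUpTo_of_statement {ε : ℝ} (hε : 0 ≤ ε) (h : P.Statement) : StatementUpTo P ε :=
  statementUpTo_mono hε (statementUpTo_zero_iff.mpr h)

/-- A weakening by `ε ≤ 0` gives the printed Statement back. [claim: Mochizuki2012, status: disputed] -/
theorem statement_of_statementUpTo_nonpos {ε : ℝ} (hε : ε ≤ 0) (h : StatementUpTo P ε) : P.Statement :=
  statementUpTo_zero_iff.mp (statementUpTo_mono hε h)

/-! ## §4. Finite supports (Prop. 3.9 (iii): all but finitely many local terms vanish) -/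

/-- Per label, the q-pilot local log-volumes are finitely supported over `v_ℚ` (a field of the setting). [folklore] -/
theorem qLocal_support_finite (i : Fin T.lstar) :
    (Function.support fun vQ : T.VQ => P.qLocal (labelSucc i) vQ).Finite :=
  P.qSupport_finite (labelSucc i)

/-- Per label, the packet-hull log-volumes are finitely supported over `v_ℚ` (from `ThetaFinite`). [folklore] -/
theorem hullLogvol_support_finite (H : BridgeHyps P) (i : Fin T.lstar) :
    (Function.support fun vQ : T.VQ => (S.D P.n).logvol (labelSucc i) vQ (P.thetaHull (labelSucc i) vQ)).Finite := by
  simpa only [thetaLocal_untopD H] using H.finite.2 i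

/-- Per label, the remainder's summand is finitely supported over `v_ℚ` (its support lies in the union of the two above). [folklore] -/
theorem indicator_deficit_support_finite (H : BridgeHyps P) (σ : Set (Fin T.lstar × T.VQ)) (i : Fin T.lstar) :
    (Function.support fun vQ : T.VQ =>
      σᶜ.indicator (fun t : Fin T.lstar × T.VQ => max (cellDeficit P t.1 t.2) 0) (i, vQ)).Finite := by
  refine ((qLocal_support_finite (P := P) i).union (hullLogvol_support_finite H i)).subset fun vQ hvQ => ?_
  by_contra hn
  simp only [Set.mem_union, Function.mem_support, not_or, not_not] at hn
  refine hvQ ?_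
  have hd : cellDeficit P i vQ = 0 := by unfold cellDeficit; rw [hn.1, hn.2, sub_zero]
  show σᶜ.indicator (fun t : Fin T.lstar × T.VQ => max (cellDeficit P t.1 t.2) 0) (i, vQ) = 0
  by_cases hm : (i, vQ) ∈ σᶜ
  · rw [Set.indicator_of_mem hm]
    show max (cellDeficit P i vQ) 0 = 0
    rw [hd, max_self]
  · exact Set.indicator_of_notMem hm _

/-- `R_Σ` is ANTITONE in the stratum: enlarging `Σ` can only lower the charge. [folklore] -/
theorem offRemainder_anti (H : BridgeHyps P) {σ σ' : Set (Fin T.lstar × T.VQ)} (h : σ ⊆ σ') :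
    offRemainder P σ' ≤ offRemainder P σ := by
  unfold offRemainder processionNormalized
  refine div_le_div_of_nonneg_right (Finset.sum_le_sum fun i _ => ?_) (Nat.cast_nonneg _)
  refine finsum_le_finsum' (indicator_deficit_support_finite H σ' i) (indicator_deficit_support_finite H σ i) fun vQ => ?_
  exact Set.indicator_le_indicator_of_subset (Set.compl_subset_compl.mpr h) (fun _ => le_max_right _ _) _

/-! ## §5. THE KERNEL TARGET: restricted licence ⟹ Cor. 3.12 weakened by the off-Σ remainder -/

/-- Cell-wise inequality: at every cell, `q-volume ≤ hull-volume + (off-Σ indicator of the deficit's positive part)` — by monotonicity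
of the log-volume on `Σ` (the licence), by the definition of the deficit off `Σ`. [claim: Mochizuki2012, status: disputed] -/
theorem qLocal_le_hull_add_indicator (H : BridgeHyps P) {σ : Set (Fin T.lstar × T.VQ)} (hσ : LicenceOn P σ)
    (i : Fin T.lstar) (vQ : T.VQ) :
    P.qLocal (labelSucc i) vQ ≤ (S.D P.n).logvol (labelSucc i) vQ (P.thetaHull (labelSucc i) vQ) +
      σᶜ.indicator (fun t : Fin T.lstar × T.VQ => max (cellDeficit P t.1 t.2) 0) (i, vQ) := by
  by_cases ht : (i, vQ) ∈ σ
  · rw [Set.indicator_of_notMem (Set.notMem_compl_iff.mpr ht), add_zero]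
    exact H.mono i vQ (P.hul_adm _ vQ _ (P.qRegion_mem _ vQ)) (P.thetaHull_adm (hullDefined_of_finite H i vQ)) (hσ _ ht)
  · rw [Set.indicator_of_mem (Set.mem_compl ht)]
    show P.qLocal (labelSucc i) vQ ≤
      (S.D P.n).logvol (labelSucc i) vQ (P.thetaHull (labelSucc i) vQ) + max (cellDeficit P i vQ) 0
    have hmax : cellDeficit P i vQ ≤ max (cellDeficit P i vQ) 0 := le_max_left _ _
    have hdef : cellDeficit P i vQ =
        P.qLocal (labelSucc i) vQ - (S.D P.n).logvol (labelSucc i) vQ (P.thetaHull (labelSucc i) vQ) := rfl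
    linarith

/-- **R-H ROUND 2 Q2, generic kernel target (PROVED): «S restricted to Σ ⟹ Cor. 3.12 weakened by the off-Σ remainder».** Under the bridge
hypotheses of abc-iut-c312-6 (monotone log-volume, admissibility, `ThetaFinite`), if the (xi-f) licence holds at every cell of `Σ`, then
`−|log(Θ)| ∈ ℝ` and `−|log(q)| ≤ −|log(Θ)| + R_Σ`. At `Σ = univ` (`R = 0`) this is abc-iut-c312-1's `statement_of_licence`.
«follows AS TYPED»; no side taken on [IUTchIII] Cor. 3.12. [claim: Mochizuki2012, status: disputed] -/
theorem statementUpTo_offRemainder_of_licenceOn (H : BridgeHyps P) {σ : Set (Fin T.lstar × T.VQ)} (hσ : LicenceOn P σ) :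
    StatementUpTo P (offRemainder P σ) := by
  have hΘ : P.negLogTheta =
      ((processionNormalized fun i : Fin T.lstar =>
          ∑ᶠ vQ : T.VQ, (S.D P.n).logvol (labelSucc i) vQ (P.thetaHull (labelSucc i) vQ) : ℝ) : WithTop ℝ) := by
    unfold Setting.negLogTheta
    rw [if_pos H.finite]
    simp only [thetaLocal_untopD H]
  refine ⟨by rw [hΘ]; exact WithTop.coe_ne_top, ?_⟩
  rw [hΘ, ← WithTop.coe_add, WithTop.coe_le_coe]
  unfold Setting.negLogQ offRemainder
  refine processionNormalized_le_add fun i => ?_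
  rw [← finsum_add_distrib (hullLogvol_support_finite H i) (indicator_deficit_support_finite H σ i)]
  refine finsum_le_finsum' (qLocal_support_finite (P := P) i)
    (((hullLogvol_support_finite H i).union (indicator_deficit_support_finite H σ i)).subset
      (Function.support_add _ _)) fun vQ => ?_
  exact qLocal_le_hull_add_indicator H hσ i vQ

/-- **HYPOTHESIS-FREE corollary: Cor. 3.12 ALWAYS holds up to the remainder of the cells where OUR typed licence fails** (Σ := the licence
cells themselves). The honest kernel content of the ROUND-1 reading «the hypothesis is TRUE precisely on stratum Σ»: every question about the
printed inequality at a setting satisfying the bridge hypotheses is a question about the size of `R_{Σ_lic}`. [claim: Mochizuki2012, status: disputed] -/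
theorem statementUpTo_offRemainder_licenceCells (H : BridgeHyps P) :
    StatementUpTo P (offRemainder P (licenceCells P)) :=
  statementUpTo_offRemainder_of_licenceOn H licenceOn_licenceCells

/-- Restricted licence + a remainder BUDGET `R_Σ ≤ ε` ⟹ Cor. 3.12 weakened by `ε` (the shape abc-iut-rh2-q2-cond's certificate consumes,
with `ε` = Q1's explicit off-Σ error). [claim: Mochizuki2012, status: disputed] -/
theorem statementUpTo_of_licenceOn_of_offRemainder_le (H : BridgeHyps P) {σ : Set (Fin T.lstar × T.VQ)} {ε : ℝ}
    (hσ : LicenceOn P σ) (hε : offRemainder P σ ≤ ε) : StatementUpTo P ε :=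
  statementUpTo_mono hε (statementUpTo_offRemainder_of_licenceOn H hσ)

/-- Restricted licence + vanishing remainder ⟹ the PRINTED Statement of Cor. 3.12. [claim: Mochizuki2012, status: disputed] -/
theorem statement_of_licenceOn_of_offRemainder_nonpos (H : BridgeHyps P) {σ : Set (Fin T.lstar × T.VQ)}
    (hσ : LicenceOn P σ) (h0 : offRemainder P σ ≤ 0) : P.Statement :=
  statement_of_statementUpTo_nonpos h0 (statementUpTo_offRemainder_of_licenceOn H hσ)

/-- In particular a restricted licence whose complement carries no positive deficit gives the printed Statement.
[claim: Mochizuki2012, status: disputed] -/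
theorem statement_of_licenceOn_of_forall_deficit_nonpos (H : BridgeHyps P) {σ : Set (Fin T.lstar × T.VQ)}
    (hσ : LicenceOn P σ) (h : ∀ t : Fin T.lstar × T.VQ, t ∉ σ → cellDeficit P t.1 t.2 ≤ 0) : P.Statement :=
  statement_of_licenceOn_of_offRemainder_nonpos H hσ (offRemainder_eq_zero_of_forall h).le

/-! ## §6. An idele-only majorant: the deficit never needs an upper bound on the hull -/

/-- **The deficit of a cell is at most «q-volume − volume of ANY possible image»** (a possible image lies in the hull; monotonicity): e.g.
with the (Ind3)-enlarged Θ-pilot region itself (`Cor312Vol.imageChoice_nonempty`), whose log-volume at the genuine bed is read off the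
Θ-ideles. [claim: Mochizuki2012, status: disputed] -/
theorem cellDeficit_le_qLocal_sub_image (H : BridgeHyps P) (U : ImageChoice P) (i : Fin T.lstar) (vQ : T.VQ) :
    cellDeficit P i vQ ≤ P.qLocal (labelSucc i) vQ - (S.D P.n).logvol (labelSucc i) vQ (U.1 (i, vQ)) := by
  unfold cellDeficit
  have hle : (S.D P.n).logvol (labelSucc i) vQ (U.1 (i, vQ)) ≤
      (S.D P.n).logvol (labelSucc i) vQ (P.thetaHull (labelSucc i) vQ) :=
    H.mono i vQ (H.image_adm i vQ _ (U.2 (i, vQ))) (P.thetaHull_adm (hullDefined_of_finite H i vQ))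
      ((Set.subset_sUnion_of_mem (U.2 (i, vQ))).trans ((P.frame _ vQ).subset_hull _))
  linarith

/-- **The off-Σ IMAGE GAP** along a global choice `U` of possible images: `(1/l⋇)·Σ_j Σ_{v_ℚ ∉ Σ} (q-volume − volume of U)⁺` — an
idele-level majorant of the remainder (no hull inside). [claim: Mochizuki2012, status: disputed] -/
@[claim "Mochizuki2012" "disputed"]
def offImageGap (P : Cor312.Setting S) (σ : Set (Fin T.lstar × T.VQ)) (U : ImageChoice P) : ℝ :=
  processionNormalized fun i : Fin T.lstar =>
    ∑ᶠ vQ : T.VQ, σᶜ.indicator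
      (fun t : Fin T.lstar × T.VQ => max (P.qLocal (labelSucc t.1) t.2 - (S.D P.n).logvol (labelSucc t.1) t.2 (U.1 t)) 0) (i, vQ)

/-- Per label, the image gap's summand is finitely supported over `v_ℚ`. [folklore] -/
theorem indicator_imageGap_support_finite (H : BridgeHyps P) (σ : Set (Fin T.lstar × T.VQ)) (U : ImageChoice P)
    (i : Fin T.lstar) :
    (Function.support fun vQ : T.VQ => σᶜ.indicator
      (fun t : Fin T.lstar × T.VQ => max (P.qLocal (labelSucc t.1) t.2 - (S.D P.n).logvol (labelSucc t.1) t.2 (U.1 t)) 0)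
        (i, vQ)).Finite := by
  have hU : (Function.support fun vQ : T.VQ => (S.D P.n).logvol (labelSucc i) vQ (U.1 (i, vQ))).Finite := by
    have h1 := H.image_fin U
    have hl : (1 / (T.lstar : ℝ)) ≠ 0 := by
      have : (0 : ℝ) < T.lstar := by exact_mod_cast Fin.pos i
      positivity
    refine (h1.preimage (f := fun vQ : T.VQ => ((i, vQ) : Fin T.lstar × T.VQ)) ?_).subset fun vQ hvQ => ?_
    · exact fun _ _ _ _ h => (Prod.mk.inj h).2
    · simp only [Set.mem_preimage, Function.mem_support, ne_eq, mul_eq_zero, hl, false_or]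
      exact hvQ
  refine ((qLocal_support_finite (P := P) i).union hU).subset fun vQ hvQ => ?_
  by_contra hn
  simp only [Set.mem_union, Function.mem_support, not_or, not_not] at hn
  refine hvQ ?_
  show σᶜ.indicator
    (fun t : Fin T.lstar × T.VQ => max (P.qLocal (labelSucc t.1) t.2 - (S.D P.n).logvol (labelSucc t.1) t.2 (U.1 t)) 0) (i, vQ) = 0
  by_cases hm : (i, vQ) ∈ σᶜ
  · rw [Set.indicator_of_mem hm]
    show max (P.qLocal (labelSucc i) vQ - (S.D P.n).logvol (labelSucc i) vQ (U.1 (i, vQ))) 0 = 0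
    rw [hn.1, hn.2, sub_zero, max_self]
  · exact Set.indicator_of_notMem hm _

/-- **`R_Σ ≤` the off-Σ image gap** along any global choice of possible images. [claim: Mochizuki2012, status: disputed] -/
theorem offRemainder_le_offImageGap (H : BridgeHyps P) (σ : Set (Fin T.lstar × T.VQ)) (U : ImageChoice P) :
    offRemainder P σ ≤ offImageGap P σ U := by
  unfold offRemainder offImageGap processionNormalized
  refine div_le_div_of_nonneg_right (Finset.sum_le_sum fun i _ => ?_) (Nat.cast_nonneg _)
  refine finsum_le_finsum' (indicator_deficit_support_finite H σ i) (indicator_imageGap_support_finite H σ U i) fun vQ => ?_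
  by_cases ht : (i, vQ) ∈ σᶜ
  · simp only [Set.indicator_of_mem ht]
    exact max_le_max (cellDeficit_le_qLocal_sub_image H U i vQ) le_rfl
  · simp only [Set.indicator_of_notMem ht, le_refl]

/-- Hence: restricted licence ⟹ Cor. 3.12 weakened by the off-Σ IMAGE GAP along any choice of possible images (idele-only error term).
[claim: Mochizuki2012, status: disputed] -/
theorem statementUpTo_offImageGap_of_licenceOn (H : BridgeHyps P) {σ : Set (Fin T.lstar × T.VQ)} (hσ : LicenceOn P σ)
    (U : ImageChoice P) : StatementUpTo P (offImageGap P σ U) :=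
  statementUpTo_mono (offRemainder_le_offImageGap H σ U) (statementUpTo_offRemainder_of_licenceOn H hσ)

/-! ## §7. Branch C's vocabulary: the S_H antecedent `PilotKummerCompatHull` restricted to Σ (the `hSHw`-shaped binder on a stratum) -/

section BranchC

variable (L : LatticeSituation T) (P' : Cor312.Setting L.toSituation)
  (ρ : (∀ v : T.V, v ∈ T.Vbad → Set (L.L.StarPacket v)) → ∀ (j : T.Label) (vQ : T.VQ), Set (L.L.Packet j vQ))
  (qK : ∀ v : T.V, v ∈ T.Vbad → Set (L.L.StarPacket v))

/-- **`PilotKummerCompatHullOn` — S_H RESTRICTED TO Σ in branch C's vocabulary**: abc-iut-w5-d068's hull-level Kummer/link-compatibility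
clause `PilotKummerCompatHull` ([IUTchIII] Cor. 3.12 Step (xi-d), «followed by formation of the holomorphic hull») demanded ONLY at the cells
of the stratum `σ` (labels `j ∈ 𝔽_l^⋇`). The window certificates' binder `hSHw` is the case `σ = univ` (at non-zero labels). READING PREDICATE,
never asserted. [claim: Mochizuki2012, status: disputed] -/
@[claim "Mochizuki2012" "disputed"]
def PilotKummerCompatHullOn (σ : Set (Fin T.lstar × T.VQ)) : Prop :=
  ∀ t ∈ σ, ρ qK (labelSucc t.1) t.2 ⊆ P'.thetaHull (labelSucc t.1) t.2

variable {L P' ρ qK}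

/-- The unrestricted clause restricts to every stratum. [claim: Mochizuki2012, status: disputed] -/
theorem pilotKummerCompatHullOn_of_pilotKummerCompatHull (σ : Set (Fin T.lstar × T.VQ)) (h : PilotKummerCompatHull L P' ρ qK) :
    PilotKummerCompatHullOn L P' ρ qK σ :=
  fun t _ => h _ t.2

/-- Under the q-pin (pq′) the restricted clause IS the restricted licence. [claim: Mochizuki2012, status: disputed] -/
theorem pilotKummerCompatHullOn_iff_licenceOn (hq : QPinned L P' ρ qK) (σ : Set (Fin T.lstar × T.VQ)) :
    PilotKummerCompatHullOn L P' ρ qK σ ↔ LicenceOn P' σ := by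
  refine forall₂_congr fun t _ => ?_
  rw [hq (labelSucc t.1) t.2]

/-- **Branch C form of the kernel target**: bridge hypotheses + q-pin + S_H on `Σ` ⟹ Cor. 3.12 weakened by the off-Σ remainder (at
`σ = univ`: abc-iut-w5-d068's `statement_of_pilotKummerCompatHull`). [claim: Mochizuki2012, status: disputed] -/
theorem statementUpTo_offRemainder_of_pilotKummerCompatHullOn (H : BridgeHyps P') (hq : QPinned L P' ρ qK)
    {σ : Set (Fin T.lstar × T.VQ)} (h : PilotKummerCompatHullOn L P' ρ qK σ) : StatementUpTo P' (offRemainder P' σ) :=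
  statementUpTo_offRemainder_of_licenceOn H ((pilotKummerCompatHullOn_iff_licenceOn hq σ).mp h)

/-- … and with a remainder budget `R_Σ ≤ ε`, Cor. 3.12 weakened by `ε`. [claim: Mochizuki2012, status: disputed] -/
theorem statementUpTo_of_pilotKummerCompatHullOn_of_le (H : BridgeHyps P') (hq : QPinned L P' ρ qK)
    {σ : Set (Fin T.lstar × T.VQ)} {ε : ℝ} (h : PilotKummerCompatHullOn L P' ρ qK σ) (hε : offRemainder P' σ ≤ ε) :
    StatementUpTo P' ε :=
  statementUpTo_mono hε (statementUpTo_offRemainder_of_pilotKummerCompatHullOn H hq h)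

end BranchC

end Summit.ABC.IUTFork.Repair.RH.SigmaLicence

end
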